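import Summits.BirchSwinnertonDyer.Rank1Residual.X2.GreenbergVatsalProPrimeToPCocycle
import Literature.NumberTheory.EllipticCurves.IwasawaLocalKummerSkeletonProofs
import Literature.NumberTheory.EllipticCurves.SelmerCorankProofs
import HarnessLib

/-!
# Cocycles of `ker κ ∩ D_v` vanishing on inertia are coboundaries, II: the TOTALLY RAMIFIED case
# (`v ∣ p`): `H¹(G_𝔭/I_𝔭, D) = 0` when `Frob − 1` is surjective on `D` (pure group theory), and
# an endomorphism of a divisible `p`-primary group with finite kernel is surjective

HONEST FRAMING (cell `b2b-bsdres`, run/shared/lean/b2b/bsd-rank1-residual/, verbatim in every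
file): the goal of the cell is to DELETE the COMBINATION-SHAPED residual classes of the
Birch–Swinnerton-Dyer formula for ALL analytic-rank `≤ 1` elliptic curves over `ℚ` — "full BSD
formula for every rank `≤ 1` curve in class `C`" assembled STRICTLY from published theorems — so
that the rank-`≤ 1` remainder becomes exactly the CONSTRUCTION-SHAPED classes, which are TYPED
(missing-input `Prop`s), NOT attempted. This is not "finishing BSD". Sub-cell
`b2b-bsdres-eisenstein-p2` (CLASS-OWNERS row "X2"), gen 10: research route; NO CLAIM BEYOND STATED
CLASSES; nothing here changes a label. THEOREMS ONLY (no `def`, no named fact, nothing asserted).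

WHY. Greenberg's local condition at `v ∣ p` comes in two printed forms: with the INERTIA group —
Greenberg 1989 (4), Greenberg–Vatsal 2000 p. 16 `L_𝔭 = ker(H¹((ℚ_∞)_𝔭, A) → H¹(I_𝔭, D))`, the
tree's `LocalDatum.greenbergKer` — and with the DECOMPOSITION group — Greenberg 1989 "strict",
Greenberg 1999 Prop. 2.4 `Im λ = ker(H¹(K, E[p^∞]) → H¹(K, Ẽ[p^∞]))`, the tree's
`LocalDatum.strictKer`. Over the cyclotomic tower at `v ∣ p` they agree because
`G_𝔭/I_𝔭 = Gal(k̄/k)` is generated by Frobenius and `H¹(⟨Frob⟩, D) = D/(Frob − 1)D = 0` for the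
divisible unramified quotient `D = Ẽ[p^∞]` (Greenberg, LNM 1716 p. 73: "`E[p^∞]/C_v` is the maximal
unramified quotient"). This file is the pure algebra of that remark; the sibling
`GreenbergVatsalStrictAtP` instantiates it for Greenberg's datum of `E/ℚ` at a good ordinary `p`.

* §1 **`exists_eq_smul_sub_of_vanishing_on_inertia_of_surjective`** — `G` profinite (the
  decomposition group), `I ⊴ G`, `P = ker κ` for `κ : G → ℤ_p` ("`Gal(K̄_v/K_{∞,η})`"), `φ ∈ P`
  with `G = φ^ℕ · I · U` for every open `U` (a Frobenius INSIDE `P`: the tower is totally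
  ramified), the inertia "fills the layers" (`hopen`: for every open normal `U`, deep values of `κ`
  are values of `κ` on `U ∩ I`), `D` a discrete `G`-module with `I` acting trivially and `φ − 1`
  SURJECTIVE on `D`: every continuous `1`-cocycle `P → D` vanishing on `P ∩ I` is a coboundary.
  Proof: subtract `∂d` with `g(φ) = φd − d`; the zero set is an open subgroup of `P` containing `φ`
  and `P ∩ I`; writing `x = φⁿ i u` and re-splitting `i u = i' u'` with `i' ∈ P ∩ I`,
  `u' ∈ P ∩ U` (possible by `hopen`) shows it is everything.
* §2 **`surjective_of_finite_ker_of_divisible`** — an additive endomorphism `f` of a `p`-primary,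
  `p`-divisible abelian group `D` with finite `p^k`-torsion for all `k` and finite kernel is
  SURJECTIVE (`#ker f · D[p^m] ⊆ f(D)` by counting in the finite group `D[p^m]`, and
  `#ker f · D = D` by divisibility).

References: Greenberg, Adv. Stud. Pure Math. 17 (1989) p. 98 ((4) and "strict"); Greenberg,
LNM 1716 (1999) §2 pp. 73–75; Greenberg–Vatsal (2000) §2 pp. 16, 26; Serre, *Galois
Cohomology*, I §2, I §5; XIII §1 (`H¹(Ẑ, A) = A/(F−1)A`).
-/

noncomputable section

open scoped Classical Pointwise

universe u

namespace Summit.BirchSwinnertonDyer.Rank1Residual.X2.GreenbergVatsalStrictCore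

open Literature.NumberTheory.GaloisRepresentations Literature.NumberTheory.EllipticCurves
  Literature.NumberTheory.EllipticCurves.ResKernel

/-! ## §1. The totally ramified case: a Frobenius inside `P` -/

section Cocycle

variable {G : Type u} [Group G] [TopologicalSpace G] [IsTopologicalGroup G] [CompactSpace G]
  [TotallyDisconnectedSpace G]
variable {D : Type u} [AddCommGroup D] [DistribMulAction G D] [TopologicalSpace D]
  [DiscreteTopology D]
variable {p : ℕ} [Fact p.Prime]

/-- **`H¹(P/(P ∩ I), D) = 0` in the totally ramified case.** Let `G` be a profinite group,
`I ≤ G` a subgroup normalised by `G`, `κ : G → ℤ_p` a homomorphism with kernel `P`, `φ ∈ P` such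
that `G = φ^ℕ · I · U` for every open subgroup `U` (Frobenius generation), such that for every open
normal `U` there is `B` with `κ(U ∩ I) ⊇ κ(G) ∩ p^B ℤ_p` (`hopen`; "the inertia group surjects onto
`Gal(K_∞/K)`") and `κ ≡ 0 (mod p^B)` on some open subgroup for each `B` (`hlayer`). Let `D` be a
discrete `G`-module with continuous orbit maps on which `I` acts trivially and `φ − 1` is
surjective. Then every continuous `1`-cocycle of `P` with values in `D` vanishing on `P ∩ I` is a
coboundary. (Serre, *Local Fields* XIII §1: `H¹(Ẑ, A) = A/(F − 1)A`; Greenberg 1999 p. 73.)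
[cite: GreenbergLNM1716, §2 p. 73] [cite: SerreGaloisCohomology1997, I §5.1] -/
theorem exists_eq_smul_sub_of_vanishing_on_inertia_of_surjective {I P : Subgroup G}
    (hIn : ∀ g : G, ∀ i ∈ I, g * i * g⁻¹ ∈ I) {φ : G} (hφP : φ ∈ P)
    (hdec : ∀ U : Subgroup G, IsOpen (U : Set G) → ∀ d : G,
      ∃ (n : ℕ) (i u : G), i ∈ I ∧ u ∈ U ∧ d = φ ^ n * i * u)
    (κ : G →* Multiplicative ℤ_[p]) (hP : ∀ {x : G}, x ∈ P ↔ κ x = 1)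
    (hopen : ∀ U : Subgroup G, U.Normal → IsOpen (U : Set G) → ∃ B : ℕ, ∀ u : G,
      (p : ℤ_[p]) ^ B ∣ (κ u).toAdd → ∃ w ∈ U, w ∈ I ∧ κ w = κ u)
    (hlayer : ∀ B : ℕ, ∃ V : Subgroup G, IsOpen (V : Set G) ∧
      ∀ v ∈ V, (p : ℤ_[p]) ^ B ∣ (κ v).toAdd)
    (hcont : ∀ d : D, Continuous fun g : G ↦ g • d)
    (hID : ∀ i ∈ I, ∀ d : D, i • d = d) (hsurj : ∀ d : D, ∃ d' : D, φ • d' - d' = d)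
    (g : contOneCocycles (discreteTopRep P D)) (hg : ∀ x : P, (x : G) ∈ I → g.1 x = 0) :
    ∃ b : D, ∀ x : P, g.1 x = (x : G) • b - b := by
  have _ := hIn
  obtain ⟨d, hd⟩ := hsurj (g.1 ⟨φ, hφP⟩)
  set cb : contOneCocycles (discreteTopRep P D) :=
    cobCocycle d ((hcont d).comp continuous_subtype_val) with hcb
  have hδ : ∀ x : P, (g - cb).1 x = g.1 x - ((x : G) • d - d) := fun x ↦ by
    rw [Submodule.coe_sub, ContinuousMap.sub_apply]; rfl
  set Z := zeroSubgroup (g - cb) with hZ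
  have hZφ : (⟨φ, hφP⟩ : P) ∈ Z := by
    rw [mem_zeroSubgroup_iff, hδ, ← hd]; exact sub_self _
  have hZI : ∀ x : P, (x : G) ∈ I → x ∈ Z := fun x hx ↦ by
    rw [mem_zeroSubgroup_iff, hδ, hg x hx, hID _ hx d, sub_self, sub_zero]
  -- an open normal `U` with `U ∩ P ⊆ Z`
  have hz : IsOpen (Z : Set P) := isOpen_zeroSubgroup _
  obtain ⟨O, hO, hOeq⟩ := isOpen_induced_iff.mp hz
  have h1O : (1 : G) ∈ O := by
    have : (1 : P) ∈ Subtype.val ⁻¹' O := by rw [hOeq]; exact Z.one_mem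
    exact this
  obtain ⟨Un, hUn⟩ := ProfiniteGrp.exist_openNormalSubgroup_sub_open_nhds_of_one hO h1O
  have hUZ : ∀ x : P, (x : G) ∈ (Un : Set G) → x ∈ Z := fun x hx ↦ by
    have : x ∈ Subtype.val ⁻¹' O := hUn hx
    rw [hOeq] at this
    exact this
  obtain ⟨B, hB⟩ := hopen Un.toSubgroup inferInstance Un.isOpen
  obtain ⟨V, hV, hVB⟩ := hlayer B
  refine ⟨d, fun x ↦ ?_⟩
  suffices hxZ : x ∈ Z by
    rw [mem_zeroSubgroup_iff, hδ, sub_eq_zero] at hxZ; exact hxZ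
  obtain ⟨n, i, u, hi, hu, hx⟩ := hdec (Un.toSubgroup ⊓ V) (Un.isOpen.inter hV) x
  obtain ⟨huU, huV⟩ := Subgroup.mem_inf.1 hu
  obtain ⟨w, hwU, hwI, hκw⟩ := hB u (hVB u huV)
  -- `κ i * κ u = 1`
  have hκx : κ x = 1 := hP.1 x.2
  have hκφ : κ φ = 1 := hP.1 hφP
  have hκiu : κ i * κ u = 1 := by
    have h := congrArg κ hx
    rw [hκx, map_mul, map_mul, map_pow, hκφ, one_pow, one_mul] at h
    exact h.symm
  -- re-split `i u = i' u'` with `i' = i w ∈ P ∩ I`, `u' = w⁻¹ u ∈ P ∩ U`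
  have hi'P : i * w ∈ P := hP.2 (by rw [map_mul, hκw, hκiu])
  have hu'P : w⁻¹ * u ∈ P := hP.2 (by rw [map_mul, map_inv, hκw, inv_mul_cancel])
  have hi'Z : (⟨i * w, hi'P⟩ : P) ∈ Z := hZI _ (I.mul_mem hi hwI)
  have hu'Z : (⟨w⁻¹ * u, hu'P⟩ : P) ∈ Z := hUZ _ (Un.toSubgroup.mul_mem (Un.toSubgroup.inv_mem hwU) huU)
  have e : x = ⟨φ, hφP⟩ ^ n * ⟨i * w, hi'P⟩ * ⟨w⁻¹ * u, hu'P⟩ := by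
    apply Subtype.ext
    simp only [Subgroup.coe_mul, SubgroupClass.coe_pow]
    rw [hx]; group
  rw [e]
  exact Z.mul_mem (Z.mul_mem (Z.pow_mem hZφ n) hi'Z) hu'Z

end Cocycle

/-! ## §2. Endomorphisms with finite kernel of divisible `p`-primary groups are surjective -/

section Surjective

variable {D : Type u} [AddCommGroup D] {p : ℕ} [Fact p.Prime]

/-- In a finite abelian group `A`, for an endomorphism `f`, `#(A ⧸ f(A)) = #ker f`. [folklore] -/
theorem natCard_quotient_range_eq_natCard_ker {A : Type*} [AddCommGroup A] [Finite A] (f : A →+ A) :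
    Nat.card (A ⧸ f.range) = Nat.card f.ker := by
  have h1 := AddSubgroup.card_eq_card_quotient_mul_card_addSubgroup f.ker
  have h2 := AddSubgroup.card_eq_card_quotient_mul_card_addSubgroup f.range
  have h3 : Nat.card (A ⧸ f.ker) = Nat.card f.range :=
    Nat.card_congr (QuotientAddGroup.quotientKerEquivRange f).toEquiv
  rw [h3] at h1
  have hpos : 0 < Nat.card f.range := Nat.card_pos
  have : Nat.card (A ⧸ f.range) * Nat.card f.range = Nat.card f.ker * Nat.card f.range := by
    rw [← h2, h1, mul_comm]
  exact Nat.eq_of_mul_eq_mul_right hpos this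

/-- **`#ker f · a ∈ f(D)` for every `a` of finite additive order dividing... in a finite `f`-stable
subgroup**: if `A ≤ D` is a finite subgroup with `f(A) ⊆ A`, then `#(ker f) • a ∈ f(A)` for all
`a ∈ A`. [folklore] -/
theorem natCard_ker_nsmul_mem_map (f : D →+ D) [Finite f.ker] (A : AddSubgroup D) [Finite A]
    (hA : ∀ a ∈ A, f a ∈ A) (a : D) (ha : a ∈ A) :
    ∃ a' ∈ A, f a' = Nat.card f.ker • a := by
  -- the restriction `fA : A →+ A`
  set fA : A →+ A := (f.restrict A).codRestrict A (fun x ↦ hA x x.2) with hfA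
  have hfA_apply : ∀ x : A, ((fA x : A) : D) = f x := fun x ↦ rfl
  -- `#(A/fA(A)) = #ker fA ∣ #ker f`
  have hq := natCard_quotient_range_eq_natCard_ker fA
  have hdvd : Nat.card fA.ker ∣ Nat.card f.ker := by
    refine AddSubgroup.card_dvd_of_injective
      ((A.subtype.comp fA.ker.subtype).codRestrict f.ker fun x ↦ ?_) ?_
    · rw [AddMonoidHom.mem_ker, AddMonoidHom.comp_apply, AddSubgroup.subtype_apply,
        AddSubgroup.subtype_apply, ← hfA_apply, (AddMonoidHom.mem_ker).1 x.2, ZeroMemClass.coe_zero]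
    · intro x y hxy
      have h := congrArg Subtype.val hxy
      exact Subtype.ext (Subtype.ext h)
  obtain ⟨c, hc⟩ := hdvd
  -- `#(A/fA(A)) • (mk a) = 0`, i.e. `#ker fA • a ∈ fA(A)`
  have hmem : Nat.card fA.ker • (⟨a, ha⟩ : A) ∈ fA.range := by
    rw [← hq, ← QuotientAddGroup.eq_zero_iff, QuotientAddGroup.mk_nsmul]
    exact card_nsmul_eq_zero'
  obtain ⟨x, hx⟩ := hmem
  refine ⟨((c • x : A) : D), (c • x).2, ?_⟩
  rw [hc, mul_comm, mul_nsmul', ← hfA_apply, map_nsmul]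
  rw [hx]
  rfl

/-- **An additive endomorphism with finite kernel of a `p`-divisible `p`-primary group with finite
`p^k`-torsion is surjective** (`D ≅ (ℚ_p/ℤ_p)^r`: such `f` has finite cokernel, which is divisible,
hence zero). Proof without structure theory: `#ker f · D[p^m] ⊆ f(D)` for every `m`
(`natCard_ker_nsmul_mem_map`), and every `d` is `#ker f · a` for a torsion `a` (divisibility by
`p^c` and invertibility of the prime-to-`p` part of `#ker f` on `p`-power torsion). [folklore] -/
theorem surjective_of_finite_ker_of_divisible (f : D →+ D)
    (htor : ∀ d : D, ∃ k : ℕ, p ^ k • d = 0) (hdiv : ∀ d : D, ∃ d' : D, p • d' = d)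
    (hfin : ∀ k : ℕ, Set.Finite {d : D | p ^ k • d = 0}) (hker : Set.Finite (f.ker : Set D)) :
    Function.Surjective f := by
  haveI : Finite f.ker := hker.to_subtype
  set N₀ := Nat.card f.ker with hN₀
  have hN₀0 : N₀ ≠ 0 := Nat.card_pos.ne'
  obtain ⟨c, m', hm', hcm⟩ := Nat.exists_eq_pow_mul_and_not_dvd hN₀0 p (Fact.out : p.Prime).ne_one
  intro d
  -- `d = p^c • d₁`
  obtain ⟨d₁, rfl⟩ := exists_pow_smul_eq_of_forall_exists_smul_eq p hdiv c d
  obtain ⟨k, hk⟩ := htor d₁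
  -- `m'` is invertible on `d₁`
  have hcop : Nat.Coprime m' (p ^ k) :=
    (Nat.Coprime.pow_right k ((Nat.Prime.coprime_iff_not_dvd Fact.out).2 hm').symm)
  have hbez : (m' : ℤ) * Nat.gcdA m' (p ^ k) + ((p ^ k : ℕ) : ℤ) * Nat.gcdB m' (p ^ k) = 1 := by
    have h := Nat.gcd_eq_gcd_ab m' (p ^ k)
    rw [Nat.Coprime.gcd_eq_one hcop] at h
    exact_mod_cast h.symm
  set a : D := Nat.gcdA m' (p ^ k) • d₁ with ha
  have hm'a : m' • a = d₁ := by
    have h1 : d₁ = ((m' : ℤ) * Nat.gcdA m' (p ^ k)) • d₁ +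
        (((p ^ k : ℕ) : ℤ) * Nat.gcdB m' (p ^ k)) • d₁ := by rw [← add_smul, hbez, one_smul]
    have h2 : (((p ^ k : ℕ) : ℤ) * Nat.gcdB m' (p ^ k)) • d₁ = 0 := by
      rw [mul_comm, mul_smul, natCast_zsmul, hk, smul_zero]
    rw [h2, add_zero, mul_smul, natCast_zsmul] at h1
    rw [ha, ← h1]
  -- `a` is `p^k`-torsion, so lies in the finite `f`-stable subgroup `D[p^k]`
  set A : AddSubgroup D := (DistribSMul.toAddMonoidHom D (p ^ k)).ker with hA
  have hAmem : ∀ x : D, x ∈ A ↔ p ^ k • x = 0 := fun x ↦ by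
    rw [hA, AddMonoidHom.mem_ker, DistribSMul.toAddMonoidHom_apply]
  haveI : Finite A := by
    have e : (A : Set D) = {d : D | p ^ k • d = 0} := by ext x; exact hAmem x
    have hf := hfin k
    rw [← e] at hf
    exact hf.to_subtype
  have haA : a ∈ A := by
    rw [hAmem, ha, smul_comm, hk, smul_zero]
  have hfA : ∀ x ∈ A, f x ∈ A := fun x hx ↦ by
    rw [hAmem] at hx ⊢
    rw [← map_nsmul, hx, map_zero]
  obtain ⟨a', -, ha'⟩ := natCard_ker_nsmul_mem_map f A hfA a haA
  refine ⟨a', ?_⟩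
  rw [ha', ← hN₀, hcm, mul_comm, mul_nsmul', smul_comm, hm'a]

end Surjective

end Summit.BirchSwinnertonDyer.Rank1Residual.X2.GreenbergVatsalStrictCore

end
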